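import Literature.ModelTheory.ExponentialFields.SemialgebraicWing
import HarnessLib

/-!
# The basic extension lemma (Pawłucki's Lemma 5.4 for `p = 1`, straightened spine)

Topic `Literature/ModelTheory/ExponentialFields` — block B4₇ of the proof of the
`C¹`-triangulation theorem for compact semialgebraic sets
(`Literature.ModelTheory.ExponentialFields.OhmotoShiota2017_c1Triangulation`, statement of
[OhmotoShiota2017, Thm. 1.1]) along the proof of [Pawlucki2024], specialized to `p = 1`.

Semialgebraic towers (`Tower.SA`), monotonicity of angles in the base, the spine-bottom curve
`botPt` computing the spine limit `spineLim f = lim_{t→0⁺} f ∘ botPt`, and the semialgebraicity of the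
spine limit. These feed the packaging of [Pawlucki2024, Lemma 5.4] (`p = 1`).

No named facts are introduced (D-0026).

## References

* [Pawlucki2024] W. Pawłucki, *Strict `C^p`-triangulations — a new approach to
  desingularization*, J. Eur. Math. Soc. 26 (2024), 3863–3909, Lemma 5.4 (p = 1).
* [Dries1998] L. van den Dries, *Tame topology and o-minimal structures*, Ch. 6 (1.2).
-/

noncomputable section

open Set Filter Metric
open _root_.Topology

namespace Literature.ModelTheory.ExponentialFields

open Literature.NumberTheory.Transcendental (IsSemialgebraicFunOn IsSemialgebraicMapOn
  isSemialgebraicFunOn_iff isSemialgebraicMapOn_iff_forall_holds IsSemialgebraicFunOn.comp_isSemialgebraicMapOn_holds)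

variable {k : ℕ}

/-! ### Semialgebraic towers -/

/-- The level functions of a tower are semialgebraic on the angles. [cite: Pawlucki2024, Lemma 5.4] -/
def Tower.SA (Ω : Set (Fin k → ℝ)) : (j : ℕ) → Tower k j → Prop
  | 0, _ => True
  | j + 1, ⟨T, ℓ⟩ => Tower.SA Ω j T ∧ IsSemialgebraicFunOn ℝ (angle Ω j T) ℓ.φ ∧ IsSemialgebraicFunOn ℝ (angle Ω j T) ℓ.ψ

/-- `{x ∈ O | f x ≤ g x}` is semialgebraic. [folklore] -/
theorem sa_sep_le' {m : ℕ} {O : Set (Fin m → ℝ)} (hO : IsSemialgebraic ℝ O) {f g : (Fin m → ℝ) → ℝ}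
    (hf : IsSemialgebraicFunOn ℝ O f) (hg : IsSemialgebraicFunOn ℝ O g) : IsSemialgebraic ℝ {x | x ∈ O ∧ f x ≤ g x} := by
  have h := LadderData.sa_sep_lt hg hf
  have heq : {x | x ∈ O ∧ f x ≤ g x} = O \ {x | x ∈ O ∧ g x < f x} := by
    ext x; simp only [mem_setOf_eq, Set.mem_sdiff, not_and, not_lt]
    exact ⟨fun ⟨h1, h2⟩ => ⟨h1, fun _ => h2⟩, fun ⟨h1, h2⟩ => ⟨h1, h2 h1⟩⟩
  rw [heq]; exact hO.diff h

/-- **Angles of semialgebraic towers are semialgebraic.** [cite: Pawlucki2024, Lemma 5.4] -/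
theorem isSemialgebraic_angle {Ω : Set (Fin k → ℝ)} (hΩs : IsSemialgebraic ℝ Ω) :
    ∀ (j : ℕ) (T : Tower k j), Tower.SA Ω j T → IsSemialgebraic ℝ (angle Ω j T)
  | 0, _, _ => hΩs
  | j + 1, ⟨T, ℓ⟩, ⟨hT, hφ, hψ⟩ => by
    have hA := isSemialgebraic_angle hΩs j T hT
    set O : Set (Fin (k + j + 1) → ℝ) := {z | Fin.init z ∈ angle Ω j T} with hO
    have hOs : IsSemialgebraic ℝ O := hA.setOf_init_mem
    have hinit : IsSemialgebraicMapOn ℝ O (fun z : Fin (k + j + 1) → ℝ => Fin.init z) :=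
      (isSemialgebraicMapOn_iff_forall_holds hOs).2 fun i => isSemialgebraicFunOn_apply hOs i.castSucc
    have hφ' : IsSemialgebraicFunOn ℝ O (fun z => ℓ.φ (Fin.init z)) :=
      IsSemialgebraicFunOn.comp_isSemialgebraicMapOn_holds hφ hinit fun z hz => hz
    have hψ' : IsSemialgebraicFunOn ℝ O (fun z => ℓ.ψ (Fin.init z)) :=
      IsSemialgebraicFunOn.comp_isSemialgebraicMapOn_holds hψ hinit fun z hz => hz
    have hlast : IsSemialgebraicFunOn ℝ O (fun z : Fin (k + j + 1) → ℝ => z (Fin.last (k + j))) := isSemialgebraicFunOn_apply hOs _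
    have h1 := sa_sep_le' hOs hφ' hlast
    have h2 := sa_sep_le' hOs hlast hψ'
    have heq : angle Ω (j + 1) ⟨T, ℓ⟩ = {z | z ∈ O ∧ ℓ.φ (Fin.init z) ≤ z (Fin.last (k + j))} ∩ {z | z ∈ O ∧ z (Fin.last (k + j)) ≤ ℓ.ψ (Fin.init z)} := by
      ext z
      simp only [mem_setOf_eq, mem_inter_iff, hO]
      exact ⟨fun hz => ⟨⟨hz.1, hz.2.1⟩, hz.1, hz.2.2⟩, fun hz => ⟨hz.1.1, hz.1.2, hz.2.2⟩⟩
    rw [heq]; exact h1.inter h2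

/-! ### Monotonicity in the base -/

/-- Angles are monotone in the base. [cite: Pawlucki2024, Lemma 5.4] -/
theorem angle_mono {Ω Ω' : Set (Fin k → ℝ)} (h : Ω' ⊆ Ω) : ∀ (j : ℕ) (T : Tower k j), angle Ω' j T ⊆ angle Ω j T
  | 0, _ => h
  | j + 1, ⟨T, _⟩ => fun _ hz => ⟨angle_mono h j T hz.1, hz.2.1, hz.2.2⟩

/-- The angle over `Ω'` is the part of the angle over `Ω` above `Ω'`. [cite: Pawlucki2024, Lemma 5.4] -/
theorem angle_eq_inter {Ω Ω' : Set (Fin k → ℝ)} (h : Ω' ⊆ Ω) :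
    ∀ (j : ℕ) (T : Tower k j), angle Ω' j T = angle Ω j T ∩ {z | upart j z ∈ Ω'}
  | 0, _ => by
    ext z; simp only [angle, mem_inter_iff, mem_setOf_eq]
    exact ⟨fun hz => ⟨h hz, hz⟩, fun hz => hz.2⟩
  | j + 1, ⟨T, _⟩ => by
    ext z
    simp only [angle, mem_setOf_eq, mem_inter_iff, angle_eq_inter h j T, ← upart_init]
    tauto

/-- The tower hypotheses restrict to smaller bases. [cite: Pawlucki2024, Lemma 5.4] -/
theorem Tower.Hyp.mono {Ω Ω' : Set (Fin k → ℝ)} (h : Ω' ⊆ Ω) : ∀ (j : ℕ) (T : Tower k j), Tower.Hyp Ω j T → Tower.Hyp Ω' j T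
  | 0, _, _ => trivial
  | j + 1, ⟨T, _⟩, ⟨hT, ⟨V, hVo, hAV, hφ, hψ⟩, hle, hpinch, hthick⟩ =>
    ⟨Tower.Hyp.mono h j T hT, ⟨V, hVo, (angle_mono h j T).trans hAV, hφ, hψ⟩,
      fun w hw => hle w (angle_mono h j T hw), fun w hw => hpinch w (angle_mono h j T hw),
      fun w hw => hthick w (angle_mono h j T hw)⟩

/-- Semialgebraicity of towers restricts to smaller semialgebraic bases. [cite: Pawlucki2024, Lemma 5.4] -/
theorem Tower.SA.mono {Ω Ω' : Set (Fin k → ℝ)} (h : Ω' ⊆ Ω) (hΩ' : IsSemialgebraic ℝ Ω') :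
    ∀ (j : ℕ) (T : Tower k j), Tower.SA Ω j T → Tower.SA Ω' j T
  | 0, _, _ => trivial
  | j + 1, ⟨T, ℓ⟩, ⟨hT, hφ, hψ⟩ => by
    have hT' := Tower.SA.mono h hΩ' j T hT
    have hA' := isSemialgebraic_angle hΩ' j T hT'
    exact ⟨hT', hφ.mono (angle_mono h j T) hA', hψ.mono (angle_mono h j T) hA'⟩

/-- Punctured angles are monotone in the base. [cite: Pawlucki2024, Lemma 5.4] -/
theorem pAngle_mono {Ω Ω' : Set (Fin k → ℝ)} (h : Ω' ⊆ Ω) (j : ℕ) (T : Tower k j) : pAngle Ω' j T ⊆ pAngle Ω j T :=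
  fun _ hz => ⟨angle_mono h j T hz.1, hz.2⟩

/-- **Localization**: near a spine point over an open `Ω' ⊆ Ω` the punctured angles over `Ω'` and
`Ω` define the same filter. [cite: Pawlucki2024, Lemma 5.4] -/
theorem nhdsWithin_pAngle_eq {Ω Ω' : Set (Fin k → ℝ)} (h : Ω' ⊆ Ω) (hΩ' : IsOpen Ω') (j : ℕ) (T : Tower k j)
    {z₀ : Fin (k + j) → ℝ} (hz₀ : upart j z₀ ∈ Ω') : 𝓝[pAngle Ω' j T] z₀ = 𝓝[pAngle Ω j T] z₀ := by
  have heq : pAngle Ω' j T = pAngle Ω j T ∩ {z | upart j z ∈ Ω'} := by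
    ext z; simp only [pAngle, mem_setOf_eq, mem_inter_iff, angle_eq_inter h j T]; tauto
  rw [heq, inter_comm]
  exact nhdsWithin_inter_of_mem (mem_nhdsWithin_of_mem_nhds ((hΩ'.preimage (continuous_upart j)).mem_nhds hz₀))

/-! ### The spine-bottom curve and the spine limit -/

/-- The top of level `1`. [cite: Pawlucki2024, Lemma 5.4] -/
def psi1 : (j : ℕ) → Tower k (j + 1) → (Fin k → ℝ) → ℝ
  | 0, ⟨_, ℓ⟩ => fun a => ℓ.ψ a
  | j + 1, ⟨T, _⟩ => psi1 j T

/-- The spine-bottom curve `t ↦ (a, t, φ₂(a, t), φ₃(…), …)`. [cite: Pawlucki2024, Lemma 5.4 (proof, (5.4.9))] -/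
def botPt : (j : ℕ) → Tower k (j + 1) → (Fin k → ℝ) → ℝ → (Fin (k + (j + 1)) → ℝ)
  | 0, _ => fun a t => Fin.snoc (a : Fin (k + 0) → ℝ) t
  | j + 1, ⟨T, ℓ'⟩ => fun a t => Fin.snoc (botPt j T a t) (ℓ'.φ (botPt j T a t))

/-- **The spine limit is the limit along the spine-bottom curve.** [cite: Pawlucki2024, Lemma 5.4] -/
theorem spineLim_eq_botPt : ∀ (j : ℕ) (T : Tower k (j + 1)) (f : (Fin (k + (j + 1)) → ℝ) → ℝ) (a : Fin k → ℝ),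
    spineLim (j + 1) T f a = limUnder (𝓝[>] (0 : ℝ)) fun t => f (botPt j T a t)
  | 0, ⟨_, _⟩, _, _ => rfl
  | j + 1, ⟨⟨T₀, ℓ₀⟩, ℓ'⟩, f, a => by
    show spineLim (j + 1) ⟨T₀, ℓ₀⟩ _ a = _
    rw [spineLim_eq_botPt j ⟨T₀, ℓ₀⟩]
    rfl

/-- `upart (botPt a t) = a`. [cite: Pawlucki2024, Lemma 5.4] -/
theorem upart_botPt : ∀ (j : ℕ) (T : Tower k (j + 1)) (a : Fin k → ℝ) (t : ℝ), upart (j + 1) (botPt j T a t) = a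
  | 0, ⟨_, _⟩, a, t => by
    show upart (0 + 1) (Fin.snoc (a : Fin (k + 0) → ℝ) t) = a
    rw [upart_snoc, upart_zero]
  | j + 1, ⟨T, ℓ'⟩, a, t => by
    show upart (j + 1 + 1) (Fin.snoc (botPt j T a t) _) = a
    rw [upart_snoc, upart_botPt j T a t]

/-- `ypart (botPt a t) 0 = t`. [cite: Pawlucki2024, Lemma 5.4] -/
theorem ypart_botPt_zero : ∀ (j : ℕ) (T : Tower k (j + 1)) (a : Fin k → ℝ) (t : ℝ), ypart (j + 1) (botPt j T a t) 0 = t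
  | 0, ⟨_, _⟩, a, t => by
    show (Fin.snoc (a : Fin (k + 0) → ℝ) t : Fin (k + 0 + 1) → ℝ) (Fin.natAdd k (0 : Fin (0 + 1))) = t
    have h : (Fin.natAdd k (0 : Fin (0 + 1)) : Fin (k + (0 + 1))) = Fin.last (k + 0) := Fin.ext (by simp)
    rw [h]; exact Fin.snoc_last _ _
  | j + 1, ⟨T, ℓ'⟩, a, t => by
    show ypart (j + 1 + 1) (Fin.snoc (botPt j T a t) _) 0 = t
    rw [← ypart_init_zero, Fin.init_snoc, ypart_botPt_zero j T a t]

/-- **The spine-bottom curve lies in the angle** for `0 ≤ t ≤ ψ₁(a)`. [cite: Pawlucki2024, Lemma 5.4] -/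
theorem botPt_mem_angle {Ω : Set (Fin k → ℝ)} :
    ∀ (j : ℕ) (T : Tower k (j + 1)), Tower.Hyp Ω (j + 1) T → ∀ {a : Fin k → ℝ} {t : ℝ}, a ∈ Ω → 0 ≤ t → t ≤ psi1 j T a →
      botPt j T a t ∈ angle Ω (j + 1) T
  | 0, ⟨T, ℓ⟩, ⟨_, _, _, hpinch, _⟩, a, t, ha, h0, h1 => by
    show Fin.snoc (a : Fin (k + 0) → ℝ) t ∈ angle Ω (0 + 1) ⟨T, ℓ⟩
    rw [snoc_mem_angle_succ]
    refine ⟨ha, ?_, h1⟩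
    rw [(hpinch a ha (ypart_zero _)).1]; exact h0
  | j + 1, ⟨T, ℓ'⟩, ⟨hT, _, hle, _, _⟩, a, t, ha, h0, h1 => by
    show Fin.snoc (botPt j T a t) _ ∈ angle Ω (j + 1 + 1) ⟨T, ℓ'⟩
    rw [snoc_mem_angle_succ]
    have hmem := botPt_mem_angle j T hT ha h0 h1
    exact ⟨hmem, le_rfl, hle _ hmem⟩

/-- `ψ₁ > 0` on `Ω`. [cite: Pawlucki2024, Lemma 5.4] -/
theorem psi1_pos {Ω : Set (Fin k → ℝ)} :
    ∀ (j : ℕ) (T : Tower k (j + 1)), Tower.Hyp Ω (j + 1) T → ∀ {a : Fin k → ℝ}, a ∈ Ω → 0 < psi1 j T a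
  | 0, ⟨T, ℓ⟩, ⟨_, _, _, hpinch, hthick⟩, a, ha => by
    show 0 < ℓ.ψ a
    have h := hthick a ha (Or.inr rfl)
    rwa [(hpinch a ha (ypart_zero _)).1] at h
  | j + 1, ⟨T, _⟩, ⟨hT, _⟩, a, ha => psi1_pos j T hT ha

/-- `ψ₁` is continuous on `Ω`. [cite: Pawlucki2024, Lemma 5.4] -/
theorem continuousOn_psi1 {Ω : Set (Fin k → ℝ)} :
    ∀ (j : ℕ) (T : Tower k (j + 1)), Tower.Hyp Ω (j + 1) T → ContinuousOn (psi1 j T) Ω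
  | 0, ⟨_, _⟩, ⟨_, ⟨_, _, hAV, _, hψ⟩, _⟩ => fun a ha => (hψ.continuousOn.mono hAV) a ha
  | j + 1, ⟨T, _⟩, ⟨hT, _⟩ => continuousOn_psi1 j T hT

/-- `ψ₁` is semialgebraic on `Ω`. [cite: Pawlucki2024, Lemma 5.4] -/
theorem psi1_sa {Ω : Set (Fin k → ℝ)} :
    ∀ (j : ℕ) (T : Tower k (j + 1)), Tower.SA Ω (j + 1) T → IsSemialgebraicFunOn ℝ Ω (psi1 j T)
  | 0, ⟨_, _⟩, ⟨_, _, hψ⟩ => hψ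
  | j + 1, ⟨T, _⟩, ⟨hT, _⟩ => psi1_sa j T hT

/-- The natural domain of the spine-bottom curve. [cite: Pawlucki2024, Lemma 5.4] -/
def botDom (Ω : Set (Fin k → ℝ)) (j : ℕ) (T : Tower k (j + 1)) : Set (Fin (k + 1) → ℝ) :=
  {v | Fin.init v ∈ Ω ∧ 0 ≤ v (Fin.last k) ∧ v (Fin.last k) ≤ psi1 j T (Fin.init v)}

/-- The domain of the spine-bottom curve is semialgebraic. [cite: Pawlucki2024, Lemma 5.4] -/
theorem isSemialgebraic_botDom {Ω : Set (Fin k → ℝ)} (hΩs : IsSemialgebraic ℝ Ω) (j : ℕ) (T : Tower k (j + 1))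
    (HS : Tower.SA Ω (j + 1) T) : IsSemialgebraic ℝ (botDom Ω j T) := by
  set O : Set (Fin (k + 1) → ℝ) := {v | Fin.init v ∈ Ω} with hO
  have hOs : IsSemialgebraic ℝ O := hΩs.setOf_init_mem
  have hinit : IsSemialgebraicMapOn ℝ O (fun v : Fin (k + 1) → ℝ => Fin.init v) :=
    (isSemialgebraicMapOn_iff_forall_holds hOs).2 fun i => isSemialgebraicFunOn_apply hOs i.castSucc
  have hψ : IsSemialgebraicFunOn ℝ O (fun v => psi1 j T (Fin.init v)) :=
    IsSemialgebraicFunOn.comp_isSemialgebraicMapOn_holds (psi1_sa j T HS) hinit fun v hv => hv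
  have hlast : IsSemialgebraicFunOn ℝ O (fun v : Fin (k + 1) → ℝ => v (Fin.last k)) := isSemialgebraicFunOn_apply hOs _
  have h1 := sa_sep_le' hOs (isSemialgebraicFunOn_const' hOs 0) hlast
  have h2 := sa_sep_le' hOs hlast hψ
  have heq : botDom Ω j T = {v | v ∈ O ∧ (0 : ℝ) ≤ v (Fin.last k)} ∩ {v | v ∈ O ∧ v (Fin.last k) ≤ psi1 j T (Fin.init v)} := by
    ext v; simp only [botDom, mem_setOf_eq, mem_inter_iff, hO]
    exact ⟨fun h => ⟨⟨h.1, h.2.1⟩, h.1, h.2.2⟩, fun h => ⟨h.1.1, h.1.2, h.2.2⟩⟩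
  rw [heq]; exact h1.inter h2

/-- **The spine-bottom curve is a semialgebraic map** on its domain. [cite: Pawlucki2024, Lemma 5.4] -/
theorem botPt_sa {Ω : Set (Fin k → ℝ)} (hΩs : IsSemialgebraic ℝ Ω) :
    ∀ (j : ℕ) (T : Tower k (j + 1)), Tower.Hyp Ω (j + 1) T → Tower.SA Ω (j + 1) T →
      IsSemialgebraicMapOn ℝ (botDom Ω j T) (fun v => botPt j T (Fin.init v) (v (Fin.last k)))
  | 0, ⟨T, ℓ⟩, _, HS => by
    have hD := isSemialgebraic_botDom hΩs 0 ⟨T, ℓ⟩ HS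
    refine (isSemialgebraicMapOn_iff_forall_holds hD).2 fun i => ?_
    refine (isSemialgebraicFunOn_apply hD i).congr fun v _ => ?_
    show v i = (Fin.snoc (Fin.init v : Fin (k + 0) → ℝ) (v (Fin.last k)) : Fin (k + 0 + 1) → ℝ) i
    rw [Fin.snoc_init_self]
  | j + 1, ⟨T, ℓ'⟩, H, HS => by
    have hD := isSemialgebraic_botDom hΩs (j + 1) ⟨T, ℓ'⟩ HS
    have hD' : botDom Ω (j + 1) ⟨T, ℓ'⟩ = botDom Ω j T := rfl
    have hB := botPt_sa hΩs j T H.1 HS.1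
    rw [← hD'] at hB
    have hmaps : MapsTo (fun v : Fin (k + 1) → ℝ => botPt j T (Fin.init v) (v (Fin.last k))) (botDom Ω (j + 1) ⟨T, ℓ'⟩) (angle Ω (j + 1) T) :=
      fun v hv => botPt_mem_angle j T H.1 hv.1 hv.2.1 hv.2.2
    have hφ : IsSemialgebraicFunOn ℝ (botDom Ω (j + 1) ⟨T, ℓ'⟩) (fun v => ℓ'.φ (botPt j T (Fin.init v) (v (Fin.last k)))) :=
      IsSemialgebraicFunOn.comp_isSemialgebraicMapOn_holds HS.2.1 hB hmaps
    refine (isSemialgebraicMapOn_iff_forall_holds hD).2 fun i => ?_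
    refine Fin.lastCases ?_ (fun i' => ?_) i
    · refine hφ.congr fun v _ => ?_
      show _ = (Fin.snoc (botPt j T (Fin.init v) (v (Fin.last k))) (ℓ'.φ (botPt j T (Fin.init v) (v (Fin.last k)))) : Fin (k + (j + 1) + 1) → ℝ) (Fin.last _)
      rw [Fin.snoc_last]
    · refine (((isSemialgebraicMapOn_iff_forall_holds hD).1 hB) i').congr fun v _ => ?_
      show _ = (Fin.snoc (botPt j T (Fin.init v) (v (Fin.last k))) (ℓ'.φ (botPt j T (Fin.init v) (v (Fin.last k)))) : Fin (k + (j + 1) + 1) → ℝ) i'.castSucc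
      rw [Fin.snoc_castSucc]

/-- **The spine limit is semialgebraic** when `f` is globally semialgebraic and the spine limits exist.
[cite: Pawlucki2024, Lemma 5.4 ("it follows from (5.4.1) that `f|Σ` has an extension `g`")] -/
theorem isSemialgebraicFunOn_spineLim {Ω : Set (Fin k → ℝ)} (hΩs : IsSemialgebraic ℝ Ω) (j : ℕ)
    (T : Tower k (j + 1)) (H : Tower.Hyp Ω (j + 1) T) (HS : Tower.SA Ω (j + 1) T) {f : (Fin (k + (j + 1)) → ℝ) → ℝ}
    (hf : IsSemialgebraicFunOn ℝ univ f)
    (hlim : ∀ a ∈ Ω, Tendsto (fun t => f (botPt j T a t)) (𝓝[>] 0) (𝓝 (spineLim (j + 1) T f a))) :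
    IsSemialgebraicFunOn ℝ Ω (spineLim (j + 1) T f) := by
  classical
  set D := botDom Ω j T with hDdef
  set Fb : (Fin (k + 1) → ℝ) → ℝ := fun v => if v ∈ D then f (botPt j T (Fin.init v) (v (Fin.last k))) else 0 with hFb
  have hDs : IsSemialgebraic ℝ D := isSemialgebraic_botDom hΩs j T HS
  have hHB : IsSemialgebraic ℝ (halfBox Ω 1) := isSemialgebraic_halfBox hΩs 1
  have hFbs : IsSemialgebraicFunOn ℝ (halfBox Ω 1) Fb := by
    refine IsSemialgebraicFunOn.piecewise_mem ?_ (isSemialgebraicFunOn_const' (hHB.diff hDs) 0)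
    have hB := (botPt_sa hΩs j T H HS).mono (inter_subset_right : halfBox Ω 1 ∩ D ⊆ D) (hHB.inter hDs)
    exact IsSemialgebraicFunOn.comp_isSemialgebraicMapOn_holds hf hB fun v _ => mem_univ _
  refine isSemialgebraicFunOn_lim hΩs subset_rfl one_pos hFbs fun a ha => ?_
  have hev : ∀ᶠ t in 𝓝[>] (0 : ℝ), Fb (Fin.snoc a t) = f (botPt j T a t) := by
    have hψ : ∀ᶠ t in 𝓝[>] (0 : ℝ), t < psi1 j T a :=
      Filter.eventually_of_mem (Ioo_mem_nhdsGT (psi1_pos j T H ha)) fun t ht => ht.2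
    filter_upwards [hψ, self_mem_nhdsWithin] with t ht ht0
    have hmem : (Fin.snoc a t : Fin (k + 1) → ℝ) ∈ D := by
      refine ⟨by simpa using ha, ?_, ?_⟩
      · simp only [Fin.snoc_last]; exact le_of_lt ht0
      · simp only [Fin.snoc_last, Fin.init_snoc]; exact ht.le
    simp only [hFb, if_pos hmem, Fin.init_snoc, Fin.snoc_last]
  exact (hlim a ha).congr' (hev.mono fun t ht => ht.symm)

/-! ### The bad set of a tangential derivative is semialgebraic -/

section BadSet

variable {Ω : Set (Fin k → ℝ)} {j : ℕ} {T : Tower k (j + 1)} {U : Set (Fin (k + (j + 1)) → ℝ)} {h : (Fin (k + (j + 1)) → ℝ) → ℝ}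

/-- The lifted level graph `Y = {(z, ε) : z ∈ Å ∩ U, 0 < ε ≤ |h z|}`. [cite: Pawlucki2024, Lemma 5.4 (proof, (5.4.3))] -/
def levelLift (Ω : Set (Fin k → ℝ)) (j : ℕ) (T : Tower k (j + 1)) (U : Set (Fin (k + (j + 1)) → ℝ))
    (h : (Fin (k + (j + 1)) → ℝ) → ℝ) : Set (Fin (k + (j + 1) + 1) → ℝ) :=
  {W | Fin.init W ∈ pAngle Ω (j + 1) T ∩ U ∧ 0 < W (Fin.last _) ∧ W (Fin.last _) ≤ |h (Fin.init W)|}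

/-- The bad set: vertex points `a` with `((a, 0), ε) ∈ closure Y` for some `ε > 0`.
[cite: Pawlucki2024, Lemma 5.4 (proof, (5.4.3))] -/
def badSet (Ω : Set (Fin k → ℝ)) (j : ℕ) (T : Tower k (j + 1)) (U : Set (Fin (k + (j + 1)) → ℝ))
    (h : (Fin (k + (j + 1)) → ℝ) → ℝ) : Set (Fin k → ℝ) :=
  {a | ∃ ε : ℝ, 0 < ε ∧ (Fin.snoc (spinePt (j + 1) a) ε : Fin (k + (j + 1) + 1) → ℝ) ∈ closure (levelLift Ω j T U h)}

/-- The lifted level graph is semialgebraic. [cite: Pawlucki2024, Lemma 5.4] -/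
theorem isSemialgebraic_levelLift (hpAs : IsSemialgebraic ℝ (pAngle Ω (j + 1) T)) (hUs : IsSemialgebraic ℝ U)
    (hh : IsSemialgebraicFunOn ℝ U h) : IsSemialgebraic ℝ (levelLift Ω j T U h) := by
  set O : Set (Fin (k + (j + 1) + 1) → ℝ) := {W | Fin.init W ∈ pAngle Ω (j + 1) T ∩ U} with hO
  have hOs : IsSemialgebraic ℝ O := (hpAs.inter hUs).setOf_init_mem
  have hinit : IsSemialgebraicMapOn ℝ O (fun W : Fin (k + (j + 1) + 1) → ℝ => Fin.init W) :=
    (isSemialgebraicMapOn_iff_forall_holds hOs).2 fun i => isSemialgebraicFunOn_apply hOs i.castSucc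
  have hh' : IsSemialgebraicFunOn ℝ O (fun W => |h (Fin.init W)|) :=
    (IsSemialgebraicFunOn.comp_isSemialgebraicMapOn_holds hh hinit fun W hW => hW.2).abs
  have hlast : IsSemialgebraicFunOn ℝ O (fun W : Fin (k + (j + 1) + 1) → ℝ => W (Fin.last _)) := isSemialgebraicFunOn_apply hOs _
  have h1 := LadderData.sa_sep_lt (isSemialgebraicFunOn_const' hOs 0) hlast
  have h2 := sa_sep_le' hOs hlast hh'
  have heq : levelLift Ω j T U h = {W | W ∈ O ∧ (0 : ℝ) < W (Fin.last _)} ∩ {W | W ∈ O ∧ W (Fin.last _) ≤ |h (Fin.init W)|} := by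
    ext W; simp only [levelLift, mem_setOf_eq, mem_inter_iff, hO]
    exact ⟨fun h => ⟨⟨h.1, h.2.1⟩, h.1, h.2.2⟩, fun h => ⟨h.1.1, h.1.2, h.2.2⟩⟩
  rw [heq]; exact h1.inter h2

/-- The base coordinates inside `ℝᵏ⁺⁽ʲ⁺¹⁾⁺¹`. [cite: Pawlucki2024, Lemma 5.4] -/
def ιa (k j : ℕ) : Fin k → Fin (k + (j + 1) + 1) := fun l => Fin.castSucc (Fin.castAdd (j + 1) l)

/-- **The bad set is semialgebraic.** [cite: Pawlucki2024, Lemma 5.4 (proof)] -/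
theorem isSemialgebraic_badSet (hpAs : IsSemialgebraic ℝ (pAngle Ω (j + 1) T)) (hUs : IsSemialgebraic ℝ U)
    (hh : IsSemialgebraicFunOn ℝ U h) : IsSemialgebraic ℝ (badSet Ω j T U h) := by
  set C := closure (levelLift Ω j T U h) with hC
  have hCs : IsSemialgebraic ℝ C := isSemialgebraic_closure (isSemialgebraic_levelLift hpAs hUs hh)
  set Q : Set (Fin (k + (j + 1) + 1) → ℝ) := {W | (∀ i' : Fin (j + 1), W (Fin.castSucc (Fin.natAdd k i')) = 0) ∧ 0 < W (Fin.last _)} with hQ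
  have hQs : IsSemialgebraic ℝ Q := by
    have h1 : IsSemialgebraic ℝ {W : Fin (k + (j + 1) + 1) → ℝ | ∀ i' : Fin (j + 1), W (Fin.castSucc (Fin.natAdd k i')) = 0} := by
      have heq : {W : Fin (k + (j + 1) + 1) → ℝ | ∀ i' : Fin (j + 1), W (Fin.castSucc (Fin.natAdd k i')) = 0} =
          ⋂ i' ∈ (Finset.univ : Finset (Fin (j + 1))), {W | W (Fin.castSucc (Fin.natAdd k i')) = 0} := by
        ext W; simp
      rw [heq]
      exact IsSemialgebraic.biInter _ _ fun i' _ => Literature.NumberTheory.Transcendental.SemialgebraicMonotonicity.sa_eq_const _ 0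
    exact h1.inter (Literature.NumberTheory.Transcendental.SemialgebraicMonotonicity.sa_const_lt _ 0)
  have hkey : badSet Ω j T U h = (fun W : Fin (k + (j + 1) + 1) → ℝ => W ∘ ιa k j) '' (C ∩ Q) := by
    ext a
    constructor
    · rintro ⟨ε, hε, hmem⟩
      refine ⟨Fin.snoc (spinePt (j + 1) a) ε, ⟨hmem, ?_, ?_⟩, ?_⟩
      · intro i'
        rw [Fin.snoc_castSucc]
        show spinePt (j + 1) a (Fin.natAdd k i') = 0
        simp [spinePt]
      · simpa using hε
      · funext l
        simp only [Function.comp_apply, ιa, Fin.snoc_castSucc]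
        simp [spinePt]
    · rintro ⟨W, ⟨hWC, hW0, hWpos⟩, rfl⟩
      refine ⟨W (Fin.last _), hWpos, ?_⟩
      have hW : (Fin.snoc (spinePt (j + 1) (W ∘ ιa k j)) (W (Fin.last _)) : Fin (k + (j + 1) + 1) → ℝ) = W := by
        funext idx
        refine Fin.lastCases ?_ (fun i => ?_) idx
        · rw [Fin.snoc_last]
        · rw [Fin.snoc_castSucc]
          refine Fin.addCases (fun l => ?_) (fun i' => ?_) i
          · simp [spinePt, ιa]
          · simp only [spinePt, Fin.append_right, Pi.zero_apply]
            exact (hW0 i').symm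
      rw [hW]; exact hWC
  rw [hkey]
  exact (hCs.inter hQs).image_proj (ιa k j)

/-- **The bad set is the set of failure of the tangential limit.** [cite: Pawlucki2024, Lemma 5.4 (proof, (5.4.3))] -/
theorem mem_badSet_iff
    (hnear : ∀ a ∈ Ω, ∃ R > 0, ∀ z ∈ pAngle Ω (j + 1) T, dist z (spinePt (j + 1) a) < R → z ∈ U)
    {a : Fin k → ℝ} (ha : a ∈ Ω) :
    a ∈ badSet Ω j T U h ↔ ¬ Tendsto h (𝓝[pAngle Ω (j + 1) T] (spinePt (j + 1) a)) (𝓝 0) := by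
  set p := spinePt (j + 1) a with hp
  obtain ⟨R, hR, hRU⟩ := hnear a ha
  constructor
  · rintro ⟨ε, hε, hmem⟩ ht
    have hev : ∀ᶠ z in 𝓝[pAngle Ω (j + 1) T] p, |h z| < ε / 2 := by
      have := Metric.tendsto_nhds.1 ht (ε / 2) (half_pos hε)
      exact this.mono fun z hz => by rwa [Real.dist_eq, sub_zero] at hz
    obtain ⟨N, hN, hNsub⟩ := mem_nhdsWithin_iff_exists_mem_nhds_inter.1 hev
    obtain ⟨r, hr, hball⟩ := Metric.mem_nhds_iff.1 hN
    -- an open neighbourhood of `(p, ε)` missing `Y`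
    have hci : Continuous fun W : Fin (k + (j + 1) + 1) → ℝ => (Fin.init W : Fin (k + (j + 1)) → ℝ) := continuous_pi fun i => continuous_apply _
    have hO : IsOpen {W : Fin (k + (j + 1) + 1) → ℝ | (Fin.init W : Fin (k + (j + 1)) → ℝ) ∈ ball p r ∧ ε / 2 < W (Fin.last _)} :=
      ((isOpen_ball (x := p) (ε := r)).preimage hci).inter (isOpen_lt continuous_const (continuous_apply (Fin.last _)))
    have hmemO : (Fin.snoc p ε : Fin (k + (j + 1) + 1) → ℝ) ∈ {W : Fin (k + (j + 1) + 1) → ℝ | (Fin.init W : Fin (k + (j + 1)) → ℝ) ∈ ball p r ∧ ε / 2 < W (Fin.last _)} := by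
      refine ⟨?_, ?_⟩
      · show Fin.init (Fin.snoc p ε : Fin (k + (j + 1) + 1) → ℝ) ∈ ball p r; rw [Fin.init_snoc]; exact mem_ball_self hr
      · show ε / 2 < (Fin.snoc p ε : Fin (k + (j + 1) + 1) → ℝ) (Fin.last _); rw [Fin.snoc_last]; exact half_lt_self hε
    obtain ⟨W, hWO, hWY⟩ := mem_closure_iff_nhds.1 hmem _ (hO.mem_nhds hmemO)
    have h1 : |h (Fin.init W)| < ε / 2 := hNsub ⟨hball hWO.1, hWY.1.1⟩
    linarith [hWY.2.2, hWO.2]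
  · intro hnt
    rw [Metric.tendsto_nhds] at hnt
    push Not at hnt
    obtain ⟨ε, hε, hfreq⟩ := hnt
    refine ⟨ε, hε, ?_⟩
    have hevU : ∀ᶠ z in 𝓝[pAngle Ω (j + 1) T] p, z ∈ pAngle Ω (j + 1) T ∧ z ∈ U := by
      have hb : ∀ᶠ z in 𝓝[pAngle Ω (j + 1) T] p, dist z p < R := mem_nhdsWithin_of_mem_nhds (ball_mem_nhds _ hR)
      filter_upwards [hb, self_mem_nhdsWithin] with z hz hz'
      exact ⟨hz', hRU z hz' hz⟩
    have hfr : ∃ᶠ z in 𝓝 p, (Fin.snoc z ε : Fin (k + (j + 1) + 1) → ℝ) ∈ levelLift Ω j T U h := by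
      have h2 := (hfreq.and_eventually hevU).filter_mono (nhdsWithin_le_nhds (s := pAngle Ω (j + 1) T) (a := p))
      refine h2.mono fun z hz => ?_
      have h3 : ε ≤ dist (h z) 0 := hz.1
      rw [Real.dist_eq, sub_zero] at h3
      refine ⟨?_, ?_, ?_⟩
      · show Fin.init (Fin.snoc z ε : Fin (k + (j + 1) + 1) → ℝ) ∈ _; rw [Fin.init_snoc]; exact hz.2
      · show 0 < (Fin.snoc z ε : Fin (k + (j + 1) + 1) → ℝ) (Fin.last _); rw [Fin.snoc_last]; exact hε
      · show (Fin.snoc z ε : Fin (k + (j + 1) + 1) → ℝ) (Fin.last _) ≤ |h (Fin.init (Fin.snoc z ε : Fin (k + (j + 1) + 1) → ℝ))|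
        rw [Fin.snoc_last, Fin.init_snoc]; exact h3
    -- continuity of `z ↦ (z, ε)`
    have hcont : Continuous fun z : Fin (k + (j + 1)) → ℝ => (Fin.snoc z ε : Fin (k + (j + 1) + 1) → ℝ) :=
      continuous_snoc_pair.comp (continuous_id.prodMk continuous_const)
    have hcl : p ∈ closure ((fun z : Fin (k + (j + 1)) → ℝ => (Fin.snoc z ε : Fin (k + (j + 1) + 1) → ℝ)) ⁻¹' levelLift Ω j T U h) :=
      mem_closure_iff_frequently.2 hfr
    have h := image_closure_subset_closure_image hcont ⟨p, hcl, rfl⟩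
    exact closure_mono (image_preimage_subset _ _) h

end BadSet

/-! ### The packaging: Lemma 5.4 for `p = 1` -/

section Main

/-- A spine point is determined by its base. [cite: Pawlucki2024, Lemma 5.4] -/
theorem spinePt_upart_of_ypart_eq_zero (j : ℕ) {z : Fin (k + j) → ℝ} (hz : ypart j z = 0) : spinePt j (upart j z) = z := by
  conv_rhs => rw [eq_append_upart_ypart j z, hz]
  rfl

/-- `upart` of a fibre basis vector vanishes. [folklore] -/
theorem upart_single_natAdd (j : ℕ) (i : Fin j) : upart j (Pi.single (Fin.natAdd k i) (1 : ℝ) : Fin (k + j) → ℝ) = 0 := by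
  funext l; simp [upart, Pi.single_apply, Fin.ext_iff]; omega

/-- `upart` of a base basis vector. [folklore] -/
theorem upart_single_castAdd (j : ℕ) (l : Fin k) : upart j (Pi.single (Fin.castAdd j l) (1 : ℝ) : Fin (k + j) → ℝ) = Pi.single l 1 := by
  funext l'; simp [upart, Pi.single_apply, Fin.ext_iff]

/-- `ypart` of a base basis vector vanishes. [folklore] -/
theorem ypart_single_castAdd (j : ℕ) (l : Fin k) : ypart j (Pi.single (Fin.castAdd j l) (1 : ℝ) : Fin (k + j) → ℝ) = 0 := by
  funext i; simp [ypart, Pi.single_apply, Fin.ext_iff]; omega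

/-- `ypart` of a fibre basis vector. [folklore] -/
theorem ypart_single_natAdd (j : ℕ) (i : Fin j) : ypart j (Pi.single (Fin.natAdd k i) (1 : ℝ) : Fin (k + j) → ℝ) = Pi.single i 1 := by
  funext i'; simp [ypart, Pi.single_apply, Fin.ext_iff]

/-- `ypart` is continuous. [folklore] -/
theorem continuous_ypart (j : ℕ) : Continuous (ypart (k := k) j) := continuous_pi fun _ => continuous_apply _

/-- The derivative of `g ∘ upart`. [folklore] -/
theorem hasFDerivAt_comp_upart (j : ℕ) {g : (Fin k → ℝ) → ℝ} {z : Fin (k + j) → ℝ} {g' : (Fin k → ℝ) →L[ℝ] ℝ}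
    (hg : HasFDerivAt g g' (upart j z)) : HasFDerivAt (fun w => g (upart j w)) (g'.comp (upartL k j)) z := by
  have hu : HasFDerivAt (upart (k := k) j) (upartL k j) z := by
    have h := (upartL k j).hasFDerivAt (x := z)
    exact h
  exact hg.comp z hu

/-- The vertex derivative as a continuous function of its data. [cite: Pawlucki2024, Lemma 5.4] -/
theorem continuousWithinAt_vertexDeriv (j : ℕ) {S : Set (Fin k → ℝ)} {a : Fin k → ℝ}
    {D : (Fin k → ℝ) → (Fin k → ℝ) →L[ℝ] ℝ} {Gf : Fin j → (Fin k → ℝ) → ℝ}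
    (hD : ContinuousWithinAt D S a) (hG : ∀ i, ContinuousWithinAt (Gf i) S a) :
    ContinuousWithinAt (fun u => vertexDeriv k j (D u) (fun i => Gf i u)) S a := by
  simp only [vertexDeriv]
  refine (hD.clm_comp continuousWithinAt_const).add ?_
  refine tendsto_finsetSum _ fun i _ => ?_
  exact (hG i).smul continuousWithinAt_const

/-- **The basic extension lemma** [Pawlucki2024, Lemma 5.4, for `p = 1` and straightened spine
`Σ = Ω × {0}`]: let `f` be globally semialgebraic and `C¹` on an open semialgebraic `U` containing
the punctured angle near the spine, with the `y`-partials bounded near each vertex and tending,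
along the punctured angle, to continuous functions `G₀ᵢ` at every spine point. Then off a closed
small semialgebraic `E ⊆ ℝᵏ`, the spine limit `g` is `C¹`, and near every spine point over `Ω ∖ E`
the extension of `f` by `g` is `C¹` in the Whitney sense on the angle: it has a derivative field `L`
within the angle which is continuous on the angle. [cite: Pawlucki2024, Lemma 5.4] -/
theorem basic_extension {Ω : Set (Fin k → ℝ)} (hΩo : IsOpen Ω) (hΩs : IsSemialgebraic ℝ Ω) (j : ℕ) (T : Tower k (j + 1))
    (H : Tower.Hyp Ω (j + 1) T) (HS : Tower.SA Ω (j + 1) T)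
    {f : (Fin (k + (j + 1)) → ℝ) → ℝ} (hfs : IsSemialgebraicFunOn ℝ univ f)
    {U : Set (Fin (k + (j + 1)) → ℝ)} (hUo : IsOpen U) (hUs : IsSemialgebraic ℝ U) (hfC1 : ContDiffOn ℝ 1 f U)
    (hnear : ∀ a ∈ Ω, ∃ R > 0, ∀ z ∈ pAngle Ω (j + 1) T, dist z (spinePt (j + 1) a) < R → z ∈ U)
    (hgrad : ∀ a ∈ Ω, ∃ (R M : ℝ), 0 < R ∧ 0 ≤ M ∧ ∀ z ∈ pAngle Ω (j + 1) T, dist z (spinePt (j + 1) a) < R →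
      ∀ i' : Fin (j + 1), |fderiv ℝ f z (Pi.single (Fin.natAdd k i') 1)| ≤ M)
    {G₀ : Fin (j + 1) → (Fin k → ℝ) → ℝ} (hG₀c : ∀ i', ContinuousOn (G₀ i') Ω)
    (hG₀ : ∀ a ∈ Ω, ∀ i', Tendsto (fun z => fderiv ℝ f z (Pi.single (Fin.natAdd k i') 1))
      (𝓝[pAngle Ω (j + 1) T] (spinePt (j + 1) a)) (𝓝 (G₀ i' a))) :
    ∃ E : Set (Fin k → ℝ), IsSemialgebraic ℝ E ∧ IsClosed E ∧ IsSmall E ∧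
      ContDiffOn ℝ 1 (spineLim (j + 1) T f) (Ω \ E) ∧
      ∀ a ∈ Ω \ E, ∃ (R : ℝ) (L : (Fin (k + (j + 1)) → ℝ) → (Fin (k + (j + 1)) → ℝ) →L[ℝ] ℝ), 0 < R ∧
        (∀ z ∈ angle Ω (j + 1) T, dist z (spinePt (j + 1) a) < R →
          HasFDerivWithinAt (angleExt (j + 1) f (spineLim (j + 1) T f)) (L z) (angle Ω (j + 1) T) z) ∧
        ContinuousOn L (angle Ω (j + 1) T ∩ ball (spinePt (j + 1) a) R) := by
  classical
  set g := spineLim (j + 1) T f with hgdef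
  -- Step 0: `GradHyp` at every vertex
  have hGH : ∀ a ∈ Ω, ∃ R : ℝ, 0 < R ∧ ∃ M : ℝ, 0 ≤ M ∧ GradHyp Ω (j + 1) T a R M f := by
    intro a ha
    obtain ⟨Rn, hRn, hU⟩ := hnear a ha
    obtain ⟨Rg, M, hRg, hM, hbd⟩ := hgrad a ha
    refine ⟨min Rn Rg, lt_min hRn hRg, M, hM, U, hUo, fun z hz hd hy => hU z ⟨hz, hy⟩ (hd.trans_le (min_le_left _ _)),
      hfC1.differentiableOn one_ne_zero, fun z hz hd hy i => hbd z ⟨hz, hy⟩ (hd.trans_le (min_le_right _ _)) i⟩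
  -- Step 1: the spine limits exist along the spine-bottom curve
  have hVE : ∀ a ∈ Ω, ∃ (R' C' : ℝ), 0 < R' ∧ ∀ z ∈ angle Ω (j + 1) T, dist z (spinePt (j + 1) a) < R' → ypart (j + 1) z ≠ 0 →
      |f z - g (upart (j + 1) z)| ≤ C' * ‖ypart (j + 1) z‖ := by
    intro a ha
    obtain ⟨C, hC, hV⟩ := vertex_estimate hΩo ha j T H
    obtain ⟨R, hR, M, hM, hG⟩ := hGH a ha
    obtain ⟨R', hR', hV'⟩ := hV R hR
    exact ⟨R', C * M, hR', fun z hz hd hy => hV' M f hM hG z hz hd hy⟩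
  have hlimbot : ∀ a ∈ Ω, Tendsto (fun t => f (botPt j T a t)) (𝓝[>] 0) (𝓝 (g a)) := by
    intro a ha
    obtain ⟨R', C', hR', hest⟩ := hVE a ha
    obtain ⟨Csq, δsq, hCsq, hδsq, hsq⟩ := exists_norm_ypart_le' hΩo ha j T H
    have hψ := psi1_pos j T H ha
    set η := min (psi1 j T a) (min δsq (R' / (Csq + 1))) with hη
    have hηpos : 0 < η := lt_min hψ (lt_min hδsq (div_pos hR' (by linarith)))
    set Cm := max C' 0 with hCm
    have hCm0 : 0 ≤ Cm := le_max_right _ _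
    have hkey : ∀ t ∈ Ioo 0 η, |f (botPt j T a t) - g a| ≤ Cm * Csq * t := by
      intro t ht
      have htψ : t ≤ psi1 j T a := ht.2.le.trans (min_le_left _ _)
      have hmem := botPt_mem_angle j T H ha ht.1.le htψ
      have hy0 := ypart_botPt_zero j T a t
      have hyne : ypart (j + 1) (botPt j T a t) ≠ 0 := by
        intro h0; have := congrFun h0 0; rw [hy0] at this; exact ht.1.ne' this
      have hysq : ‖ypart (j + 1) (botPt j T a t)‖ ≤ Csq * t := by
        have h := hsq _ hmem (by rw [upart_botPt, dist_self]; exact hδsq)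
          (by rw [hy0, abs_of_pos ht.1]; exact ht.2.trans_le ((min_le_right _ _).trans (min_le_left _ _)))
        rwa [hy0, abs_of_pos ht.1] at h
      have hdist : dist (botPt j T a t) (spinePt (j + 1) a) < R' := by
        rw [dist_spinePt_eq, upart_botPt, dist_self, max_eq_right (norm_nonneg _)]
        have h1 : t < R' / (Csq + 1) := ht.2.trans_le ((min_le_right _ _).trans (min_le_right _ _))
        have h2 : Csq * t ≤ Csq * (R' / (Csq + 1)) := mul_le_mul_of_nonneg_left h1.le hCsq
        have h3 : Csq * (R' / (Csq + 1)) < R' := by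
          rw [mul_div_assoc', div_lt_iff₀ (by linarith)]; nlinarith
        linarith
      have h := hest _ hmem hdist hyne
      rw [upart_botPt] at h
      calc |f (botPt j T a t) - g a| ≤ C' * ‖ypart (j + 1) (botPt j T a t)‖ := h
        _ ≤ Cm * ‖ypart (j + 1) (botPt j T a t)‖ := mul_le_mul_of_nonneg_right (le_max_left _ _) (norm_nonneg _)
        _ ≤ Cm * (Csq * t) := mul_le_mul_of_nonneg_left hysq hCm0
        _ = Cm * Csq * t := by ring
    rw [Metric.tendsto_nhdsWithin_nhds]
    intro ε hε
    have hK : 0 < Cm * Csq + 1 := by nlinarith [mul_nonneg hCm0 hCsq]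
    refine ⟨min η (ε / (Cm * Csq + 1)), lt_min hηpos (div_pos hε hK), fun t ht' hd => ?_⟩
    have ht : 0 < t := ht'
    rw [Real.dist_eq, sub_zero, abs_of_pos ht] at hd
    have htη : t ∈ Ioo 0 η := ⟨ht, hd.trans_le (min_le_left _ _)⟩
    rw [Real.dist_eq]
    have h1 : t < ε / (Cm * Csq + 1) := hd.trans_le (min_le_right _ _)
    calc |f (botPt j T a t) - g a| ≤ Cm * Csq * t := hkey t htη
      _ ≤ (Cm * Csq + 1) * t := by nlinarith [mul_nonneg hCm0 hCsq, ht.le]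
      _ < (Cm * Csq + 1) * (ε / (Cm * Csq + 1)) := mul_lt_mul_of_pos_left h1 hK
      _ = ε := mul_div_cancel₀ _ hK.ne'
  -- Step 2: `g` is semialgebraic; generic `C¹`
  have hgsa : IsSemialgebraicFunOn ℝ Ω g := isSemialgebraicFunOn_spineLim hΩs j T H HS hfs hlimbot
  obtain ⟨E₁, hE₁s, hE₁c, hE₁sm, hΩ₁o, hgC1⟩ := exists_contDiffOn_off_small hΩo hgsa
  set Ω₁ := Ω \ E₁ with hΩ₁
  have hΩ₁s : IsSemialgebraic ℝ Ω₁ := hΩs.diff hE₁s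
  have hΩ₁Ω : Ω₁ ⊆ Ω := fun a ha => ha.1
  -- Step 3: the reduced function `f₁ = f - g ∘ upart` over `Ω₁`
  set f₁ : (Fin (k + (j + 1)) → ℝ) → ℝ := fun z => f z - g (upart (j + 1) z) with hf₁
  set U₁ : Set (Fin (k + (j + 1)) → ℝ) := U ∩ {z | upart (j + 1) z ∈ Ω₁} with hU₁
  have hU₁o : IsOpen U₁ := hUo.inter (hΩ₁o.preimage (continuous_upart (j + 1)))
  have hU₁s : IsSemialgebraic ℝ U₁ := hUs.inter (hΩ₁s.preimage_comp (Fin.castAdd (j + 1)))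
  have hgu : ContDiffOn ℝ 1 (fun z : Fin (k + (j + 1)) → ℝ => g (upart (j + 1) z)) {z | upart (j + 1) z ∈ Ω₁} :=
    hgC1.comp (upartL k (j + 1)).contDiff.contDiffOn fun z hz => hz
  have hf₁C1 : ContDiffOn ℝ 1 f₁ U₁ := (hfC1.mono inter_subset_left).sub (hgu.mono inter_subset_right)
  have hf₁s : IsSemialgebraicFunOn ℝ U₁ f₁ := by
    have h1 : IsSemialgebraicFunOn ℝ U₁ f := hfs.mono (subset_univ _) hU₁s
    have hup : IsSemialgebraicMapOn ℝ U₁ (upart (k := k) (j + 1)) :=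
      (isSemialgebraicMapOn_iff_forall_holds hU₁s).2 fun l => isSemialgebraicFunOn_apply hU₁s (Fin.castAdd (j + 1) l)
    have h2 : IsSemialgebraicFunOn ℝ U₁ (fun z => g (upart (j + 1) z)) :=
      IsSemialgebraicFunOn.comp_isSemialgebraicMapOn_holds (hgsa.mono hΩ₁Ω hΩ₁s) hup fun z hz => hz.2
    exact IsSemialgebraicFunOn.sub_holds h1 h2
  have H₁ : Tower.Hyp Ω₁ (j + 1) T := Tower.Hyp.mono hΩ₁Ω (j + 1) T H
  have HS₁ : Tower.SA Ω₁ (j + 1) T := Tower.SA.mono hΩ₁Ω hΩ₁s (j + 1) T HS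
  have hA₁s : IsSemialgebraic ℝ (angle Ω₁ (j + 1) T) := isSemialgebraic_angle hΩ₁s (j + 1) T HS₁
  have hpA₁s : IsSemialgebraic ℝ (pAngle Ω₁ (j + 1) T) := isSemialgebraic_pAngle (j + 1) T hA₁s
  have hnear₁ : ∀ a ∈ Ω₁, ∃ R > 0, ∀ z ∈ pAngle Ω₁ (j + 1) T, dist z (spinePt (j + 1) a) < R → z ∈ U₁ := by
    intro a ha
    obtain ⟨Rn, hRn, hU⟩ := hnear a (hΩ₁Ω ha)
    obtain ⟨r, hr, hball⟩ := Metric.isOpen_iff.1 hΩ₁o a ha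
    refine ⟨min Rn r, lt_min hRn hr, fun z hz hd => ⟨hU z (pAngle_mono hΩ₁Ω _ T hz) (hd.trans_le (min_le_left _ _)), hball ?_⟩⟩
    rw [mem_ball]
    have h := hd.trans_le (min_le_right _ _)
    rw [dist_spinePt_eq] at h
    exact (le_max_left _ _).trans_lt h
  -- the `y`-partials of `f₁` equal those of `f` on `U₁`
  have hdf₁ : ∀ z ∈ U₁, ∀ e : Fin (k + (j + 1)) → ℝ,
      fderiv ℝ f₁ z e = fderiv ℝ f z e - fderiv ℝ g (upart (j + 1) z) (upart (j + 1) e) := by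
    intro z hz e
    have h1 : HasFDerivAt f (fderiv ℝ f z) z := ((hfC1.differentiableOn one_ne_zero _ hz.1).differentiableAt (hUo.mem_nhds hz.1)).hasFDerivAt
    have hgd : HasFDerivAt g (fderiv ℝ g (upart (j + 1) z)) (upart (j + 1) z) :=
      ((hgC1.differentiableOn one_ne_zero _ hz.2).differentiableAt (hΩ₁o.mem_nhds hz.2)).hasFDerivAt
    have h2 := hasFDerivAt_comp_upart (j + 1) hgd
    have h3 : HasFDerivAt (fun w => f w - g (upart (j + 1) w))
        (fderiv ℝ f z - (fderiv ℝ g (upart (j + 1) z)).comp (upartL k (j + 1))) z := h1.sub h2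
    rw [show f₁ = fun w => f w - g (upart (j + 1) w) from rfl, h3.fderiv]
    rfl
  have hgrad₁ : ∀ a ∈ Ω₁, ∃ (R M : ℝ), 0 < R ∧ 0 ≤ M ∧ ∀ z ∈ pAngle Ω₁ (j + 1) T, dist z (spinePt (j + 1) a) < R →
      ∀ i' : Fin (j + 1), |fderiv ℝ f₁ z (Pi.single (Fin.natAdd k i') 1)| ≤ M := by
    intro a ha
    obtain ⟨Rg, M, hRg, hM, hbd⟩ := hgrad a (hΩ₁Ω ha)
    obtain ⟨R₁, hR₁, hU₁mem⟩ := hnear₁ a ha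
    refine ⟨min Rg R₁, M, lt_min hRg hR₁, hM, fun z hz hd i' => ?_⟩
    rw [hdf₁ z (hU₁mem z hz (hd.trans_le (min_le_right _ _))), upart_single_natAdd, map_zero, sub_zero]
    exact hbd z (pAngle_mono hΩ₁Ω _ T hz) (hd.trans_le (min_le_left _ _)) i'
  have hsmall₁ : ∀ a ∈ Ω₁, ∃ (R C : ℝ), 0 < R ∧ ∀ z ∈ pAngle Ω₁ (j + 1) T, dist z (spinePt (j + 1) a) < R →
      |f₁ z| ≤ C * ‖ypart (j + 1) z‖ := by
    intro a ha
    obtain ⟨R', C', hR', hest⟩ := hVE a (hΩ₁Ω ha)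
    exact ⟨R', C', hR', fun z hz hd => hest z (angle_mono hΩ₁Ω _ T hz.1) hd hz.2⟩
  -- Step 4: the bad sets
  set hfun : Fin k → (Fin (k + (j + 1)) → ℝ) → ℝ := fun i z => fderiv ℝ f₁ z (Pi.single (Fin.castAdd (j + 1) i) 1) with hhfun
  have hhs : ∀ i, IsSemialgebraicFunOn ℝ U₁ (hfun i) := fun i =>
    isSemialgebraicFunOn_partialDeriv hU₁o hU₁s hf₁s (hf₁C1.differentiableOn one_ne_zero) (Fin.castAdd (j + 1) i)
  set B : Fin k → Set (Fin k → ℝ) := fun i => Ω₁ ∩ badSet Ω₁ j T U₁ (hfun i) with hB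
  have hBs : ∀ i, IsSemialgebraic ℝ (B i) := fun i => hΩ₁s.inter (isSemialgebraic_badSet hpA₁s hU₁s (hhs i))
  have hBint : ∀ i, interior (B i) = ∅ := by
    intro i
    have hw := wing_interior_empty hΩ₁o j T H₁ hA₁s hU₁o hU₁s hf₁C1 hf₁s hnear₁ hgrad₁ hsmall₁ i
    have heq : B i = {a | a ∈ Ω₁ ∧ ¬ Tendsto (fun z => fderiv ℝ f₁ z (Pi.single (Fin.castAdd (j + 1) i) 1))
        (𝓝[pAngle Ω₁ (j + 1) T] (spinePt (j + 1) a)) (𝓝 0)} := by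
      ext a; simp only [hB, mem_inter_iff, mem_setOf_eq]
      constructor
      · rintro ⟨ha, hb⟩; exact ⟨ha, (mem_badSet_iff hnear₁ ha).1 hb⟩
      · rintro ⟨ha, hb⟩; exact ⟨ha, (mem_badSet_iff hnear₁ ha).2 hb⟩
    rw [heq]; exact hw
  have hBsm : ∀ i, IsSmall (B i) := by
    intro i
    by_cases hne : (B i).Nonempty
    · right
      by_contra hge
      have hk : sdim (B i) = k := le_antisymm (sdim_le _) (not_lt.1 hge)
      have := interior_nonempty_of_sdim_eq hne hk
      rw [hBint i] at this; exact not_nonempty_empty this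
    · left; exact not_nonempty_iff_eq_empty.1 hne
  set E : Set (Fin k → ℝ) := E₁ ∪ ⋃ i ∈ (Finset.univ : Finset (Fin k)), closure (B i) with hE
  have hEs : IsSemialgebraic ℝ E := hE₁s.union (IsSemialgebraic.biUnion _ _ fun i _ => isSemialgebraic_closure (hBs i))
  have hEc : IsClosed E := hE₁c.union (isClosed_biUnion_finset fun i _ => isClosed_closure)
  have hEsm : IsSmall E := hE₁sm.union (isSmall_biUnion _ (fun i _ => (hBsm i).closure (hBs i)) fun i _ => isSemialgebraic_closure (hBs i))
    hE₁s (IsSemialgebraic.biUnion _ _ fun i _ => isSemialgebraic_closure (hBs i))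
  have hEE₁ : Ω \ E ⊆ Ω₁ := fun a ha => ⟨ha.1, fun h => ha.2 (Or.inl h)⟩
  refine ⟨E, hEs, hEc, hEsm, hgC1.mono hEE₁, fun a ha => ?_⟩
  -- Step 5: the derivative field near a good vertex
  have haΩ₁ : a ∈ Ω₁ := hEE₁ ha
  obtain ⟨R₀, hR₀, hball₀⟩ := Metric.isOpen_iff.1 (hΩo.sdiff hEc) a ha
  obtain ⟨Rn, hRn, hUn⟩ := hnear a ha.1
  have hgood : ∀ a' ∈ ball a R₀, ∀ i, Tendsto (hfun i) (𝓝[pAngle Ω (j + 1) T] (spinePt (j + 1) a')) (𝓝 0) := by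
    intro a' ha' i
    have ha'E := hball₀ ha'
    have ha'Ω₁ : a' ∈ Ω₁ := hEE₁ ha'E
    have hnotB : a' ∉ B i := fun hb => ha'E.2 (Or.inr (mem_iUnion₂.2 ⟨i, Finset.mem_univ i, subset_closure hb⟩))
    have ht : Tendsto (hfun i) (𝓝[pAngle Ω₁ (j + 1) T] (spinePt (j + 1) a')) (𝓝 0) := by
      by_contra hnt
      exact hnotB ⟨ha'Ω₁, (mem_badSet_iff hnear₁ ha'Ω₁).2 hnt⟩
    rwa [nhdsWithin_pAngle_eq hΩ₁Ω hΩ₁o (j + 1) T (by rw [upart_spinePt]; exact ha'Ω₁)] at ht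
  set L : (Fin (k + (j + 1)) → ℝ) → (Fin (k + (j + 1)) → ℝ) →L[ℝ] ℝ := fun z =>
    if ypart (j + 1) z = 0 then vertexDeriv k (j + 1) (fderiv ℝ g (upart (j + 1) z)) (fun i' => G₀ i' (upart (j + 1) z)) else fderiv ℝ f z with hL
  set R := min R₀ Rn with hR
  have hRpos : 0 < R := lt_min hR₀ hRn
  have hbase : ∀ z : Fin (k + (j + 1)) → ℝ, dist z (spinePt (j + 1) a) < R → upart (j + 1) z ∈ ball a R₀ := by
    intro z hd
    rw [mem_ball]; rw [dist_spinePt_eq] at hd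
    exact (le_max_left _ _).trans_lt (hd.trans_le (min_le_left _ _))
  -- the vertex limit of `fderiv f` along the punctured angle
  have hvert : ∀ a' ∈ ball a R₀, Tendsto (fun z => fderiv ℝ f z) (𝓝[pAngle Ω (j + 1) T] (spinePt (j + 1) a'))
      (𝓝 (vertexDeriv k (j + 1) (fderiv ℝ g a') (fun i' => G₀ i' a'))) := by
    intro a' ha'
    have ha'Ω₁ : a' ∈ Ω₁ := hEE₁ (hball₀ ha')
    obtain ⟨R₁, hR₁, hU₁mem⟩ := hnear₁ a' ha'Ω₁
    have hevU₁ : ∀ᶠ z in 𝓝[pAngle Ω (j + 1) T] (spinePt (j + 1) a'), z ∈ U₁ := by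
      rw [← nhdsWithin_pAngle_eq hΩ₁Ω hΩ₁o (j + 1) T (by rw [upart_spinePt]; exact ha'Ω₁)]
      have hb : ∀ᶠ z in 𝓝[pAngle Ω₁ (j + 1) T] (spinePt (j + 1) a'), dist z (spinePt (j + 1) a') < R₁ :=
        mem_nhdsWithin_of_mem_nhds (ball_mem_nhds _ hR₁)
      filter_upwards [hb, self_mem_nhdsWithin] with z hz hz'
      exact hU₁mem z hz' hz
    refine tendsto_clm_of_tendsto_apply_single fun idx => ?_
    refine Fin.addCases (fun l => ?_) (fun i' => ?_) idx
    · -- tangential direction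
      have htarget : vertexDeriv k (j + 1) (fderiv ℝ g a') (fun i' => G₀ i' a') (Pi.single (Fin.castAdd (j + 1) l) 1) =
          fderiv ℝ g a' (Pi.single l 1) := by
        simp only [vertexDeriv_apply, upart_single_castAdd, ypart_single_castAdd, Pi.zero_apply, mul_zero,
          Finset.sum_const_zero, add_zero]
      rw [htarget]
      have hg' : Tendsto (fun z => fderiv ℝ g (upart (j + 1) z) (Pi.single l 1)) (𝓝[pAngle Ω (j + 1) T] (spinePt (j + 1) a'))
          (𝓝 (fderiv ℝ g a' (Pi.single l 1))) := by
        have hc : ContinuousAt (fun u => fderiv ℝ g u) a' := (hgC1.continuousOn_fderiv_of_isOpen hΩ₁o le_rfl).continuousAt (hΩ₁o.mem_nhds ha'Ω₁)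
        have hcu : Tendsto (upart (k := k) (j + 1)) (𝓝 (spinePt (j + 1) a')) (𝓝 a') := by
          have := (continuous_upart (k := k) (j + 1)).tendsto (spinePt (j + 1) a')
          rwa [upart_spinePt] at this
        exact ((hc.clm_apply continuousAt_const).tendsto.comp hcu).mono_left nhdsWithin_le_nhds
      have hsum := (hgood a' ha' l).add hg'
      rw [zero_add] at hsum
      refine hsum.congr' ?_
      filter_upwards [hevU₁] with z hz
      show hfun l z + fderiv ℝ g (upart (j + 1) z) (Pi.single l 1) = fderiv ℝ f z (Pi.single (Fin.castAdd (j + 1) l) 1)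
      simp only [hhfun]
      rw [hdf₁ z hz, upart_single_castAdd]; ring
    · have htarget : vertexDeriv k (j + 1) (fderiv ℝ g a') (fun i' => G₀ i' a') (Pi.single (Fin.natAdd k i') 1) = G₀ i' a' := by
        simp only [vertexDeriv_apply, upart_single_natAdd, ypart_single_natAdd, map_zero, zero_add]
        rw [Finset.sum_eq_single i']
        · simp
        · intro b _ hb; simp [hb]
        · intro h; exact absurd (Finset.mem_univ _) h
      rw [htarget]
      exact hG₀ a' (hΩ₁Ω ha'Ω₁) i'
  refine ⟨R, L, hRpos, fun z hz hd => ?_, fun z₀ hz₀ => ?_⟩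
  · -- differentiability within the angle
    by_cases hy : ypart (j + 1) z = 0
    · set a' := upart (j + 1) z with ha'
      have ha'b : a' ∈ ball a R₀ := hbase z hd
      have ha'Ω₁ : a' ∈ Ω₁ := hEE₁ (hball₀ ha'b)
      have hzeq : z = spinePt (j + 1) a' := (spinePt_upart_of_ypart_eq_zero (j + 1) hy).symm
      have hLz : L z = vertexDeriv k (j + 1) (fderiv ℝ g a') (fun i' => G₀ i' a') := by simp only [hL, if_pos hy]; rfl
      rw [hLz, hzeq]
      have hgd : HasFDerivAt g (fderiv ℝ g a') a' :=
        ((hgC1.differentiableOn one_ne_zero _ ha'Ω₁).differentiableAt (hΩ₁o.mem_nhds ha'Ω₁)).hasFDerivAt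
      exact hasFDerivWithinAt_vertex hΩo (hΩ₁Ω ha'Ω₁) j T H (hGH a' (hΩ₁Ω ha'Ω₁)) (fun i' => hG₀ a' (hΩ₁Ω ha'Ω₁) i') hgd
    · have hzU : z ∈ U := hUn z ⟨hz, hy⟩ (hd.trans_le (min_le_right _ _))
      have hLz : L z = fderiv ℝ f z := by simp only [hL, if_neg hy]
      rw [hLz]
      have hfd : HasFDerivAt f (fderiv ℝ f z) z := ((hfC1.differentiableOn one_ne_zero _ hzU).differentiableAt (hUo.mem_nhds hzU)).hasFDerivAt
      have heq : angleExt (j + 1) f g =ᶠ[𝓝 z] f := by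
        have hO : IsOpen {w : Fin (k + (j + 1)) → ℝ | ypart (j + 1) w ≠ 0} := isOpen_ne_fun (continuous_ypart (j + 1)) continuous_const
        filter_upwards [hO.mem_nhds hy] with w hw
        simp only [angleExt, hw, if_false]
      exact (hfd.congr_of_eventuallyEq heq).hasFDerivWithinAt
  · -- continuity of the field
    obtain ⟨hz₀A, hz₀b⟩ := hz₀
    have hd₀ : dist z₀ (spinePt (j + 1) a) < R := mem_ball.1 hz₀b
    by_cases hy : ypart (j + 1) z₀ = 0
    · set a' := upart (j + 1) z₀ with ha'
      have ha'b : a' ∈ ball a R₀ := hbase z₀ hd₀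
      have ha'Ω₁ : a' ∈ Ω₁ := hEE₁ (hball₀ ha'b)
      have hz₀eq : z₀ = spinePt (j + 1) a' := (spinePt_upart_of_ypart_eq_zero (j + 1) hy).symm
      set Λ : (Fin k → ℝ) → (Fin (k + (j + 1)) → ℝ) →L[ℝ] ℝ := fun u => vertexDeriv k (j + 1) (fderiv ℝ g u) (fun i' => G₀ i' u) with hΛ
      have hLz₀ : L z₀ = Λ a' := by simp only [hL, hΛ, if_pos hy]; rfl
      -- (β) along the spine part
      have hΛc : ContinuousAt Λ a' := by
        have h1 : ContinuousWithinAt (fun u => fderiv ℝ g u) Ω₁ a' := (hgC1.continuousOn_fderiv_of_isOpen hΩ₁o le_rfl) a' ha'Ω₁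
        have h2 : ∀ i', ContinuousWithinAt (G₀ i') Ω₁ a' := fun i' => ((hG₀c i').mono hΩ₁Ω) a' ha'Ω₁
        exact (continuousWithinAt_vertexDeriv (j + 1) h1 h2).continuousAt (hΩ₁o.mem_nhds ha'Ω₁)
      have hspine : Tendsto L (𝓝[angle Ω (j + 1) T ∩ {z | ypart (j + 1) z = 0}] z₀) (𝓝 (L z₀)) := by
        have hcu : Tendsto (upart (k := k) (j + 1)) (𝓝 z₀) (𝓝 a') := (continuous_upart (k := k) (j + 1)).tendsto z₀
        have h := (hΛc.tendsto.comp hcu).mono_left (nhdsWithin_le_nhds (s := angle Ω (j + 1) T ∩ {z | ypart (j + 1) z = 0}))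
        rw [hLz₀]
        refine h.congr' ?_
        filter_upwards [self_mem_nhdsWithin] with z hz
        have hz2 : ypart (j + 1) z = 0 := hz.2
        show Λ (upart (j + 1) z) = L z
        simp only [hL, hΛ, hz2, if_true]
      -- (α) along the punctured angle
      have hpunct : Tendsto L (𝓝[pAngle Ω (j + 1) T] z₀) (𝓝 (L z₀)) := by
        rw [hLz₀, hz₀eq]
        refine ((hvert a' ha'b).congr' ?_)
        filter_upwards [self_mem_nhdsWithin] with z hz
        simp only [hL, if_neg hz.2]
      have hunion : angle Ω (j + 1) T ∩ ball (spinePt (j + 1) a) R ⊆ pAngle Ω (j + 1) T ∪ (angle Ω (j + 1) T ∩ {z | ypart (j + 1) z = 0}) := by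
        intro z hz
        by_cases h : ypart (j + 1) z = 0
        · exact Or.inr ⟨hz.1, h⟩
        · exact Or.inl ⟨hz.1, h⟩
      have h := (hpunct.sup hspine)
      rw [← nhdsWithin_union] at h
      exact h.mono_left (nhdsWithin_mono _ hunion)
    · have hzU : z₀ ∈ U := hUn z₀ ⟨hz₀A, hy⟩ (hd₀.trans_le (min_le_right _ _))
      have hO : IsOpen {w : Fin (k + (j + 1)) → ℝ | ypart (j + 1) w ≠ 0} := isOpen_ne_fun (continuous_ypart (j + 1)) continuous_const
      have hc : ContinuousAt (fun z => fderiv ℝ f z) z₀ := (hfC1.continuousOn_fderiv_of_isOpen hUo le_rfl).continuousAt (hUo.mem_nhds hzU)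
      have heq : L =ᶠ[𝓝 z₀] fun z => fderiv ℝ f z := by
        filter_upwards [hO.mem_nhds hy] with w hw
        simp only [hL, if_neg hw]
      have hLc : ContinuousAt L z₀ := by
        have h := hc.tendsto
        have hLz₀ : L z₀ = fderiv ℝ f z₀ := by simp only [hL, if_neg hy]
        rw [ContinuousAt, hLz₀]
        exact h.congr' (heq.mono fun w hw => hw.symm)
      exact hLc.continuousWithinAt

end Main

end Literature.ModelTheory.ExponentialFields
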